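import Summits.HubbardSuperconductivity.HubbardSuperconductivity.Theorems.WeakCouplingBCSKlLindhardEnclosurePointGuards

/-!
# KL-MARGIN-SCAN reader (22) «kernel-lindhard-enclosure» — TWO-SHELL CELLS: the integrand is `1/g`, `g` is enclosed, and the cell integral of `g` sits between its corner records

Fourth brick for the two square-cell rules (chord ceiling `CeilChordSoundOrd`, Jensen floor `FloorInsideSoundOrd`), assembling the landed
generic pieces (`…CornerMean` p730658, `…SliceRegularity` p730911, `…CellIntIterated` p731061, `…PointGuards` p732435) over ONE guarded,
oriented grid cell inside the root square whose two shell statuses are certified opposite (kind `k`): (§1) the set integral of ANY integrable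
function over an oriented cell is the iterated interval integral in real coordinates; (§2) the kernel's integer enclosures `Glo`/`Ghi`
(`Cell.gLo/gHi`) satisfy `0 < Glo` and `Glo/2^40 ≤ g_k ≤ Ghi/2^40` on the cell, the two-shell integrand IS `1/g_k` there
(`Literature…lindhardIntegrand_eq_ite_inv` + status soundness), hence bounded and integrable on the cell; (§3) `g_k` is continuous,
bounded, integrable on every cell, and on a SQUARE cell `dz = b − a = d − c > 0` the corner-mean lemma with the slice constant `4(1+2|t′|)`
and the kernel slack `interpE ≥ (8/3)·2^40·(1+2|t′|)(dz/U)²` give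
`h²·(Σ gCornerLo − interpE) ≤ 4·2^40·∫_cell g_k ≤ h²·(Σ gCornerUp + interpE)`, `h = dz/U`, plus the trivial `area·Glo/2^40 ≤ ∫_cell g_k`.
Honest framing: elementary analysis over the landed kernel definitions; nothing in this file asserts a KL margin at any `t′ ≠ 0`, `K₃`, `U₀`,
the window or B1g dominance; a Kohn–Luttinger instability statement is not ODLRO and nothing here proves superconductivity in the Hubbard
model.  (p1 g26, 2026-08-29.)
-/

noncomputable section

set_option linter.dupNamespace false

namespace Summit.HubbardSuperconductivity.HubbardSuperconductivity.Theorems.KlLindhardEnclosure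

open Real Set MeasureTheory Literature.MathematicalPhysics.QuantumLattice
open Summit.HubbardSuperconductivity.HubbardSuperconductivity.Theorems

/-! ## §1 The set integral over an oriented grid cell as an iterated interval integral (any integrand) -/

/-- **GENERIC CELL ↔ ITERATED INTEGRAL**: for `0 < U`, an oriented cell (`a ≤ b`, `c ≤ d`) and ANY `f` integrable on it,
`∫_{cell} f = ∫_{a/U}^{b/U} ∫_{c/U}^{d/U} f (pt x y) dy dx` (the `…CellIntIterated` route, verbatim, for a general integrand). -/
theorem Params.setIntegral_cellSet_eq_iterated (P : Params) (hU : 0 < P.U) {a b c d : ℤ} (hab : a ≤ b) (hcd : c ≤ d)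
    (f : Momentum → ℝ) (hF : IntegrableOn f (P.cellSet a b c d) volume) :
    ∫ p in P.cellSet a b c d, f p = ∫ x in ((a : ℝ) / (P.U : ℝ))..((b : ℝ) / (P.U : ℝ)),
      ∫ y in ((c : ℝ) / (P.U : ℝ))..((d : ℝ) / (P.U : ℝ)), f (pt x y) := by
  have hU' : (0 : ℝ) < (P.U : ℝ) := by exact_mod_cast hU
  set ra := ((P.toQ a : ℚ) : ℝ) with hra
  set rb := ((P.toQ b : ℚ) : ℝ) with hrb
  set rc := ((P.toQ c : ℚ) : ℝ) with hrc
  set rd := ((P.toQ d : ℚ) : ℝ) with hrd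
  have era : ra = (a : ℝ) / (P.U : ℝ) := P.cast_toQ a
  have erb : rb = (b : ℝ) / (P.U : ℝ) := P.cast_toQ b
  have erc : rc = (c : ℝ) / (P.U : ℝ) := P.cast_toQ c
  have erd : rd = (d : ℝ) / (P.U : ℝ) := P.cast_toQ d
  have hab' : ra ≤ rb := by rw [era, erb]; exact div_le_div_of_nonneg_right (by exact_mod_cast hab) hU'.le
  have hcd' : rc ≤ rd := by rw [erc, erd]; exact div_le_div_of_nonneg_right (by exact_mod_cast hcd) hU'.le
  set S : Set (Fin 2 → ℝ) := (MeasurableEquiv.finTwoArrow (α := ℝ)) ⁻¹' (Ico ra rb ×ˢ Ico rc rd) with hS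
  have hcell : P.cellSet a b c d = (WithLp.ofLp : Momentum → (Fin 2 → ℝ)) ⁻¹' S := by
    rw [P.cellSet_eq_preimage, P.box_eq_preimage_prod]
  set G : (Fin 2 → ℝ) → ℝ := fun v => f (WithLp.toLp 2 v) with hG
  have h1 : (∫ p in P.cellSet a b c d, f p) = ∫ v in S, G v := by
    rw [hcell]
    have := (PiLp.volume_preserving_ofLp (Fin 2)).setIntegral_preimage_emb
      (MeasurableEquiv.toLp 2 (Fin 2 → ℝ)).symm.measurableEmbedding G S
    simpa [hG] using this
  have hG_int : IntegrableOn G S volume := by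
    have := ((PiLp.volume_preserving_ofLp (Fin 2)).integrableOn_comp_preimage
      (MeasurableEquiv.toLp 2 (Fin 2 → ℝ)).symm.measurableEmbedding (f := G) (s := S)).mp
    apply this
    rw [← hcell]
    have e : G ∘ (WithLp.ofLp : Momentum → (Fin 2 → ℝ)) = f := by funext p; simp [hG]
    rw [e]; exact hF
  set H : ℝ × ℝ → ℝ := fun z => G ((MeasurableEquiv.finTwoArrow (α := ℝ)).symm z) with hH
  have hHG : ∀ v, H (MeasurableEquiv.finTwoArrow (α := ℝ) v) = G v := fun v => by
    simp only [hH, MeasurableEquiv.symm_apply_apply]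
  have h2 : (∫ v in S, G v) = ∫ z in Ico ra rb ×ˢ Ico rc rd, H z := by
    have key := (volume_preserving_finTwoArrow ℝ).setIntegral_preimage_emb
      (MeasurableEquiv.finTwoArrow (α := ℝ)).measurableEmbedding H (Ico ra rb ×ˢ Ico rc rd)
    simp_rw [hHG] at key
    rw [hS]; exact key
  have hH_int : IntegrableOn H (Ico ra rb ×ˢ Ico rc rd) (volume.prod volume) := by
    have := ((volume_preserving_finTwoArrow ℝ).integrableOn_comp_preimage
      (MeasurableEquiv.finTwoArrow (α := ℝ)).measurableEmbedding (f := H) (s := Ico ra rb ×ˢ Ico rc rd)).mp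
    have e : H ∘ (MeasurableEquiv.finTwoArrow (α := ℝ)) = G := funext hHG
    rw [e] at this
    exact this hG_int
  have h3 : (∫ z in Ico ra rb ×ˢ Ico rc rd, H z) = ∫ x in Ico ra rb, ∫ y in Ico rc rd, H (x, y) := by
    have := setIntegral_prod H hH_int
    simpa [Measure.volume_eq_prod] using this
  have h4 : (∫ x in Ico ra rb, ∫ y in Ico rc rd, H (x, y)) = ∫ x in ra..rb, ∫ y in rc..rd, H (x, y) := by
    rw [intervalIntegral.integral_of_le hab', setIntegral_congr_set Ico_ae_eq_Ioc]
    congr 1; funext x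
    rw [intervalIntegral.integral_of_le hcd', setIntegral_congr_set Ico_ae_eq_Ioc]
  rw [h1, h2, h3, h4, era, erb, erc, erd]
  rfl

/-! ## §2 Two-shell cells: the integrand is `1/g`, and `g` is enclosed by the cell data -/

/-- Lower integer enclosure `Glo` of `2^40 · g_k` on a cell from its data (the kernel's `Glo`). [folklore] -/
def Cell.gLo (c : Cell) (k : Bool) : ℤ := if k then c.e2Lo - c.e1Hi else c.e1Lo - c.e2Hi

/-- Upper integer enclosure `Ghi` of `2^40 · g_k` on a cell from its data (the kernel's `Ghi`). [folklore] -/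
def Cell.gHi (c : Cell) (k : Bool) : ℤ := if k then c.e2Hi - c.e1Lo else c.e1Hi - c.e2Lo

/-- **TWO-SHELL STATUSES FORCE `0 < Glo`** (as an integer): `e1Hi/2^40 < μ ≤ e2Lo/2^40` (kind `true`), resp. the mirror image. -/
theorem Params.gLo_pos (P : Params) (hP : P.admissible = true) {c : Cell} {k : Bool} (hs1 : P.status c.e1Lo c.e1Hi = some k)
    (hs2 : P.status c.e2Lo c.e2Hi = some (!k)) : 0 < c.gLo k := by
  obtain ⟨-, hmuD, -, -, -⟩ := P.admissible_facts hP
  cases k with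
  | true =>
    have h1 := P.status_true_lt hmuD hs1
    have h2 := P.status_false_le hmuD (by simpa using hs2)
    have : ((c.e1Hi : ℤ) : ℝ) < ((c.e2Lo : ℤ) : ℝ) := by
      have := lt_of_lt_of_le h1 h2
      rwa [div_lt_div_iff_of_pos_right (by positivity)] at this
    have : c.e1Hi < c.e2Lo := by exact_mod_cast this
    simp only [Cell.gLo, ↓reduceIte]; omega
  | false =>
    have h1 := P.status_false_le hmuD hs1
    have h2 := P.status_true_lt hmuD (by simpa using hs2)
    have : ((c.e2Hi : ℤ) : ℝ) < ((c.e1Lo : ℤ) : ℝ) := by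
      have := lt_of_lt_of_le h2 h1
      rwa [div_lt_div_iff_of_pos_right (by positivity)] at this
    have : c.e2Hi < c.e1Lo := by exact_mod_cast this
    simp only [Cell.gLo, Bool.false_eq_true, ↓reduceIte]; omega

/-- **`g` IS ENCLOSED AND POSITIVE ON A TWO-SHELL CELL**: for admissible `P`, a guarded cell inside the root square with statuses
`(some k, some !k)` and `p` in the cell: `Glo/2^40 ≤ g_k(p) ≤ Ghi/2^40` and `0 < g_k(p)`. -/
theorem Params.twoShell_gfun_mem (P : Params) (hP : P.admissible = true) {a b c d : ℤ} (hin : P.InRoot a b c d) {k : Bool}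
    (hg : (P.cell (P.mkX a) (P.mkX b) (P.mkY c) (P.mkY d)).guards = true)
    (hs1 : P.status (P.cell (P.mkX a) (P.mkX b) (P.mkY c) (P.mkY d)).e1Lo (P.cell (P.mkX a) (P.mkX b) (P.mkY c) (P.mkY d)).e1Hi = some k)
    (hs2 : P.status (P.cell (P.mkX a) (P.mkX b) (P.mkY c) (P.mkY d)).e2Lo (P.cell (P.mkX a) (P.mkX b) (P.mkY c) (P.mkY d)).e2Hi = some (!k))
    {p : Momentum} (hp : p ∈ P.cellSet a b c d) :
    (((P.cell (P.mkX a) (P.mkX b) (P.mkY c) (P.mkY d)).gLo k : ℤ) : ℝ) / 2 ^ 40 ≤ P.gfun k p ∧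
    P.gfun k p ≤ (((P.cell (P.mkX a) (P.mkX b) (P.mkY c) (P.mkY d)).gHi k : ℤ) : ℝ) / 2 ^ 40 ∧ 0 < P.gfun k p := by
  obtain ⟨-, hmuD, -, -, -⟩ := P.admissible_facts hP
  obtain ⟨ha, -, -, hb, hc, -, -, hd⟩ := hin
  obtain ⟨e1l, e1h⟩ := P.cell_band_mem hP ha hb hc hd hg hp
  obtain ⟨e2l, e2h⟩ := P.cell_band_shift_mem hP ha hb hc hd hg hp
  cases k with
  | true =>
    have h1 := P.status_true_lt hmuD hs1
    have h2 := P.status_false_le hmuD (by simpa using hs2)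
    simp only [Cell.gLo, Cell.gHi, Params.gfun, ↓reduceIte, Int.cast_sub, sub_div]
    exact ⟨by linarith, by linarith, by linarith⟩
  | false =>
    have h1 := P.status_false_le hmuD hs1
    have h2 := P.status_true_lt hmuD (by simpa using hs2)
    simp only [Cell.gLo, Cell.gHi, Params.gfun, Bool.false_eq_true, ↓reduceIte, Int.cast_sub, sub_div]
    exact ⟨by linarith, by linarith, by linarith⟩

/-- **ON A TWO-SHELL CELL THE INTEGRAND IS `1/g`**: the two occupations differ (statuses sound), so by
`Literature…lindhardIntegrand_eq_ite_inv` `F(p) = 1/(|ε_p − μ| + |ε_{p+q} − μ|) = 1/g_k(p)`. -/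
theorem Params.twoShell_integrand_eq (P : Params) (hP : P.admissible = true) {a b c d : ℤ} (hin : P.InRoot a b c d) {k : Bool}
    (hg : (P.cell (P.mkX a) (P.mkX b) (P.mkY c) (P.mkY d)).guards = true)
    (hs1 : P.status (P.cell (P.mkX a) (P.mkX b) (P.mkY c) (P.mkY d)).e1Lo (P.cell (P.mkX a) (P.mkX b) (P.mkY c) (P.mkY d)).e1Hi = some k)
    (hs2 : P.status (P.cell (P.mkX a) (P.mkX b) (P.mkY c) (P.mkY d)).e2Lo (P.cell (P.mkX a) (P.mkX b) (P.mkY c) (P.mkY d)).e2Hi = some (!k))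
    {p : Momentum} (hp : p ∈ P.cellSet a b c d) : P.integrand p = 1 / P.gfun k p := by
  obtain ⟨-, hmuD, -, -, -⟩ := P.admissible_facts hP
  obtain ⟨ha, -, -, hb, hc, -, -, hd⟩ := hin
  obtain ⟨e1l, e1h⟩ := P.cell_band_mem hP ha hb hc hd hg hp
  obtain ⟨e2l, e2h⟩ := P.cell_band_shift_mem hP ha hb hc hd hg hp
  unfold Params.integrand
  rw [lindhardIntegrand_eq_ite_inv]
  cases k with
  | true =>
    have h1 : P.band p < ((P.mu : ℚ) : ℝ) := lt_of_le_of_lt e1h (P.status_true_lt hmuD hs1)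
    have h2 : ¬ P.band (p + P.qv) < ((P.mu : ℚ) : ℝ) := not_lt.mpr ((P.status_false_le hmuD (by simpa using hs2)).trans e2l)
    have hne : fermiOccupation P.band ((P.mu : ℚ) : ℝ) p ≠ fermiOccupation P.band ((P.mu : ℚ) : ℝ) (p + P.qv) := by
      simp [fermiOccupation, h1, h2]
    rw [if_neg hne, abs_of_neg (by linarith), abs_of_nonneg (by linarith [not_lt.mp h2])]
    simp only [Params.gfun, ↓reduceIte]
    congr 1; ring
  | false =>
    have h1 : ¬ P.band p < ((P.mu : ℚ) : ℝ) := not_lt.mpr ((P.status_false_le hmuD hs1).trans e1l)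
    have h2 : P.band (p + P.qv) < ((P.mu : ℚ) : ℝ) := lt_of_le_of_lt e2h (P.status_true_lt hmuD (by simpa using hs2))
    have hne : fermiOccupation P.band ((P.mu : ℚ) : ℝ) p ≠ fermiOccupation P.band ((P.mu : ℚ) : ℝ) (p + P.qv) := by
      simp [fermiOccupation, h1, h2]
    rw [if_neg hne, abs_of_nonneg (by linarith [not_lt.mp h1]), abs_of_neg (by linarith)]
    simp only [Params.gfun, Bool.false_eq_true, ↓reduceIte]
    congr 1; ring

/-- **THE INTEGRAND IS INTEGRABLE ON A TWO-SHELL CELL** (bounded by `2^40/Glo ≤ 2^40` on a cell of finite measure). -/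
theorem Params.twoShell_integrableOn (P : Params) (hP : P.admissible = true) {a b c d : ℤ} (hin : P.InRoot a b c d) {k : Bool}
    (hg : (P.cell (P.mkX a) (P.mkX b) (P.mkY c) (P.mkY d)).guards = true)
    (hs1 : P.status (P.cell (P.mkX a) (P.mkX b) (P.mkY c) (P.mkY d)).e1Lo (P.cell (P.mkX a) (P.mkX b) (P.mkY c) (P.mkY d)).e1Hi = some k)
    (hs2 : P.status (P.cell (P.mkX a) (P.mkX b) (P.mkY c) (P.mkY d)).e2Lo (P.cell (P.mkX a) (P.mkX b) (P.mkY c) (P.mkY d)).e2Hi = some (!k)) :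
    IntegrableOn P.integrand (P.cellSet a b c d) volume := by
  have hGlo := P.gLo_pos hP hs1 hs2
  have hGlo' : (1 : ℝ) ≤ (((P.cell (P.mkX a) (P.mkX b) (P.mkY c) (P.mkY d)).gLo k : ℤ) : ℝ) := by exact_mod_cast hGlo
  have hbd : ∀ p ∈ P.cellSet a b c d, ‖P.integrand p‖ ≤ 2 ^ 40 := by
    intro p hp
    rw [Real.norm_of_nonneg (P.integrand_nonneg p), P.twoShell_integrand_eq hP hin hg hs1 hs2 hp]
    obtain ⟨hlo, -, hpos⟩ := P.twoShell_gfun_mem hP hin hg hs1 hs2 hp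
    rw [div_le_iff₀ hpos]
    have : (1 : ℝ) / 2 ^ 40 ≤ P.gfun k p := le_trans (by rw [div_le_div_iff_of_pos_right (by positivity)]; exact hGlo') hlo
    have h2 : (1 : ℝ) ≤ 2 ^ 40 * P.gfun k p := by rw [div_le_iff₀ (by positivity)] at this; linarith
    linarith
  exact Measure.integrableOn_of_bounded (P.volume_cellSet_lt_top a b c d).ne P.measurable_integrand.aestronglyMeasurable
    (ae_restrict_of_forall_mem (P.measurableSet_cellSet a b c d) hbd)

/-! ## §3 The band difference: continuity, integrability, the corner-mean estimate on a square cell -/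

/-- `|t′| ≤ 9/20` for admissible `P` (real form). -/
theorem Params.abs_tp_le (P : Params) (hP : P.admissible = true) : |(P.tpN : ℝ) / (P.tpD : ℝ)| ≤ 9 / 20 := by
  obtain ⟨htpD, -, -, -, -⟩ := P.admissible_facts hP
  have ht : 20 * |P.tpN| ≤ 9 * P.tpD := by
    simp only [Params.admissible, Bool.and_eq_true, decide_eq_true_eq] at hP; exact hP.1.1.1.1.1.1.1.1.2
  have htpD' : (0 : ℝ) < (P.tpD : ℝ) := by exact_mod_cast htpD
  have ht' : 20 * |(P.tpN : ℝ)| ≤ 9 * (P.tpD : ℝ) := by exact_mod_cast ht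
  rw [abs_div, abs_of_pos htpD', div_le_div_iff₀ htpD' (by norm_num)]
  linarith

/-- The band is bounded: `|ε(p)| ≤ 4 + 4|t′|`. -/
theorem Params.abs_band_le (P : Params) (p : Momentum) : |P.band p| ≤ 4 + 4 * |(P.tpN : ℝ) / (P.tpD : ℝ)| := by
  rw [P.band_apply]
  set t := (P.tpN : ℝ) / (P.tpD : ℝ)
  have h0 := Real.abs_cos_le_one (p 0)
  have h1 := Real.abs_cos_le_one (p 1)
  have hcc : |Real.cos (p 0) * Real.cos (p 1)| ≤ 1 := by
    rw [abs_mul]; exact mul_le_one₀ h0 (abs_nonneg _) h1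
  calc |-2 * (Real.cos (p 0) + Real.cos (p 1)) - 4 * t * Real.cos (p 0) * Real.cos (p 1)|
      ≤ |-2 * (Real.cos (p 0) + Real.cos (p 1))| + |4 * t * Real.cos (p 0) * Real.cos (p 1)| := abs_sub _ _
    _ = 2 * |Real.cos (p 0) + Real.cos (p 1)| + 4 * |t| * |Real.cos (p 0) * Real.cos (p 1)| := by
        rw [abs_mul, abs_neg, show (4 : ℝ) * t * Real.cos (p 0) * Real.cos (p 1) = (4 * t) * (Real.cos (p 0) * Real.cos (p 1)) by ring,
          abs_mul, abs_mul]; norm_num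
    _ ≤ 2 * (|Real.cos (p 0)| + |Real.cos (p 1)|) + 4 * |t| * 1 := by
        gcongr
        · exact abs_add_le _ _
    _ ≤ 4 + 4 * |t| := by nlinarith [abs_nonneg t]

/-- The band is continuous. -/
theorem Params.continuous_band (P : Params) : Continuous P.band := by
  unfold Params.band squareDispersion; fun_prop

/-- The band difference is continuous. -/
theorem Params.continuous_gfun (P : Params) (k : Bool) : Continuous (P.gfun k) := by
  have h1 := P.continuous_band
  have h2 : Continuous fun p : Momentum => P.band (p + P.qv) := h1.comp (continuous_id.add continuous_const)
  change Continuous (fun p => P.gfun k p)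
  cases k
  · simp only [Params.gfun, Bool.false_eq_true, ↓reduceIte]; exact h1.sub h2
  · simp only [Params.gfun, ↓reduceIte]; exact h2.sub h1

/-- The band difference is bounded: `|g_k(p)| ≤ 8 + 8|t′|`. -/
theorem Params.abs_gfun_le (P : Params) (k : Bool) (p : Momentum) : |P.gfun k p| ≤ 8 + 8 * |(P.tpN : ℝ) / (P.tpD : ℝ)| := by
  have h1 := P.abs_band_le p
  have h2 := P.abs_band_le (p + P.qv)
  cases k <;> simp only [Params.gfun, Bool.false_eq_true, ↓reduceIte] <;>
    [exact (abs_sub _ _).trans (by linarith); exact (abs_sub _ _).trans (by linarith)]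

/-- The band difference is integrable on every grid cell. -/
theorem Params.gfun_integrableOn (P : Params) (k : Bool) (a b c d : ℤ) : IntegrableOn (P.gfun k) (P.cellSet a b c d) volume :=
  Measure.integrableOn_of_bounded (P.volume_cellSet_lt_top a b c d).ne (P.continuous_gfun k).measurable.aestronglyMeasurable
    (ae_restrict_of_forall_mem (P.measurableSet_cellSet a b c d) fun p _ => by
      rw [Real.norm_eq_abs]; exact P.abs_gfun_le k p)

/-- `bandDiffFn` is jointly continuous in `(x, y)`. -/
theorem continuous_bandDiffFn_uncurry (t q1 q2 : ℝ) : Continuous (Function.uncurry (bandDiffFn t q1 q2)) := by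
  have : Function.uncurry (bandDiffFn t q1 q2) = fun z : ℝ × ℝ =>
      (-2 * (Real.cos (z.1 + q1) + Real.cos (z.2 + q2)) - 4 * t * Real.cos (z.1 + q1) * Real.cos (z.2 + q2)) -
        (-2 * (Real.cos z.1 + Real.cos z.2) - 4 * t * Real.cos z.1 * Real.cos z.2) := by
    funext z; rfl
  rw [this]; fun_prop

/-- **THE CORNER-MEAN ESTIMATE FOR `bandDiffFn` ON A SQUARE** `[x0, x0 + h] × [y0, y0 + h]` (`0 < h`):
`|∫∫ g − h²·(corner mean)| ≤ h² · (2/3)(1 + 2|t′|) h²`. -/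
theorem bandDiffFn_corner_mean (t q1 q2 : ℝ) {x0 x1 y0 y1 : ℝ} (hx : x0 < x1) (hy : y0 < y1) (hsq : y1 - y0 = x1 - x0) :
    |(∫ x in x0..x1, ∫ y in y0..y1, bandDiffFn t q1 q2 x y) - (x1 - x0) * (y1 - y0) *
        (bandDiffFn t q1 q2 x0 y0 + bandDiffFn t q1 q2 x0 y1 + bandDiffFn t q1 q2 x1 y0 + bandDiffFn t q1 q2 x1 y1) / 4|
      ≤ (x1 - x0) ^ 2 * (2 / 3 * (1 + 2 * |t|) * (x1 - x0) ^ 2) := by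
  have hc := continuous_bandDiffFn_uncurry t q1 q2
  have key := corner_mean_error_le (f := bandDiffFn t q1 q2) (ζx := 4 * (1 + 2 * |t|)) (ζy := 4 * (1 + 2 * |t|)) hx.le hy.le
    (fun x => (bandDiffFn_slice_y_bound t q1 q2 hy x).1) (fun x s => (bandDiffFn_slice_y_bound t q1 q2 hy x).2 s)
    (bandDiffFn_slice_x_bound t q1 q2 hx y0).1 (bandDiffFn_slice_x_bound t q1 q2 hx y0).2
    (bandDiffFn_slice_x_bound t q1 q2 hx y1).1 (bandDiffFn_slice_x_bound t q1 q2 hx y1).2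
    ((intervalIntegral.continuous_parametric_intervalIntegral_of_continuous' hc y0 y1).intervalIntegrable _ _)
    ((hc.comp (continuous_id.prodMk continuous_const)).intervalIntegrable _ _)
    ((hc.comp (continuous_id.prodMk continuous_const)).intervalIntegrable _ _)
  refine key.trans (le_of_eq ?_)
  rw [hsq]; ring

/-- `(8/3)·2^40·(1 + 2|t′|)·(dz/U)² ≤ interpE dz` (the kernel's slack majorises the corner-mean error times `4D`). -/
theorem Params.interpE_ge (P : Params) (hP : P.admissible = true) (dz : ℤ) :
    8 / 3 * 2 ^ 40 * (1 + 2 * |(P.tpN : ℝ) / (P.tpD : ℝ)|) * ((dz : ℝ) / (P.U : ℝ)) ^ 2 ≤ ((P.interpE dz : ℤ) : ℝ) := by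
  obtain ⟨htpD, -, hU, -, -⟩ := P.admissible_facts hP
  have htpD' : (0 : ℝ) < (P.tpD : ℝ) := by exact_mod_cast htpD
  have hU' : (0 : ℝ) < (P.U : ℝ) := by exact_mod_cast hU
  have hden : 0 < 3 * P.tpD * P.U ^ 2 := by positivity
  have h := div_le_cdivZ (8 * D * (P.tpD + 2 * |P.tpN|) * dz ^ 2) (3 * P.tpD * P.U ^ 2) hden
  have h' := (Rat.cast_le (K := ℝ)).mpr h
  simp only [Params.interpE]
  push_cast [D] at h' ⊢
  refine le_trans (le_of_eq ?_) h'
  rw [abs_div, abs_of_pos htpD']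
  field_simp
  ring

/-- **THE CELL INTEGRAL OF `g` AGAINST ITS CORNER RECORDS** (square two-shell geometry not needed — any oriented square cell inside
the root square): with `h = dz/U`, `dz = b − a = d − c > 0`,
`h²·(Σ gCornerLo − interpE) ≤ 4·2^40·∫_cell g_k ≤ h²·(Σ gCornerUp + interpE)`. -/
theorem Params.integral_gfun_corner_bounds (P : Params) (hP : P.admissible = true) (k : Bool) {a b c d : ℤ}
    (hin : P.InRoot a b c d) (hab : a < b) (hsq : d - c = b - a) :
    (((b - a : ℤ) : ℝ) / (P.U : ℝ)) ^ 2 * ((P.gCornerLo k (P.mkX a) (P.mkY c) + P.gCornerLo k (P.mkX b) (P.mkY c) +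
        P.gCornerLo k (P.mkX a) (P.mkY d) + P.gCornerLo k (P.mkX b) (P.mkY d) - P.interpE (b - a) : ℤ) : ℝ)
      ≤ 4 * 2 ^ 40 * ∫ p in P.cellSet a b c d, P.gfun k p ∧
    4 * 2 ^ 40 * ∫ p in P.cellSet a b c d, P.gfun k p ≤
      (((b - a : ℤ) : ℝ) / (P.U : ℝ)) ^ 2 * ((P.gCornerUp k (P.mkX a) (P.mkY c) + P.gCornerUp k (P.mkX b) (P.mkY c) +
        P.gCornerUp k (P.mkX a) (P.mkY d) + P.gCornerUp k (P.mkX b) (P.mkY d) + P.interpE (b - a) : ℤ) : ℝ) := by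
  obtain ⟨htpD, -, hU, -, -⟩ := P.admissible_facts hP
  have hU' : (0 : ℝ) < (P.U : ℝ) := by exact_mod_cast hU
  have hcd : c < d := by omega
  obtain ⟨ha1, ha2, hb1, hb2, hc1, hc2, hd1, hd2⟩ := hin
  have hx : (a : ℝ) / (P.U : ℝ) < (b : ℝ) / (P.U : ℝ) := div_lt_div_of_pos_right (by exact_mod_cast hab) hU'
  have hy : (c : ℝ) / (P.U : ℝ) < (d : ℝ) / (P.U : ℝ) := div_lt_div_of_pos_right (by exact_mod_cast hcd) hU'
  have hsq' : (d : ℝ) / (P.U : ℝ) - (c : ℝ) / (P.U : ℝ) = (b : ℝ) / (P.U : ℝ) - (a : ℝ) / (P.U : ℝ) := by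
    rw [← sub_div, ← sub_div]
    congr 1; exact_mod_cast hsq
  have hh : ((b - a : ℤ) : ℝ) / (P.U : ℝ) = (b : ℝ) / (P.U : ℝ) - (a : ℝ) / (P.U : ℝ) := by push_cast; ring
  -- the cell integral as σ · ∫∫ bandDiffFn
  have hI : (∫ p in P.cellSet a b c d, P.gfun k p) = (if k then (1 : ℝ) else -1) *
      ∫ x in ((a : ℝ) / (P.U : ℝ))..((b : ℝ) / (P.U : ℝ)), ∫ y in ((c : ℝ) / (P.U : ℝ))..((d : ℝ) / (P.U : ℝ)),
        bandDiffFn ((P.tpN : ℝ) / (P.tpD : ℝ)) ((P.q1z : ℝ) / (P.U : ℝ)) ((P.q2z : ℝ) / (P.U : ℝ)) x y := by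
    rw [P.setIntegral_cellSet_eq_iterated hU hab.le hcd.le (P.gfun k) (P.gfun_integrableOn k a b c d)]
    simp_rw [P.gfun_pt k]
    rw [← intervalIntegral.integral_const_mul]
    congr 1; funext x
    rw [← intervalIntegral.integral_const_mul]
  have hcm := bandDiffFn_corner_mean ((P.tpN : ℝ) / (P.tpD : ℝ)) ((P.q1z : ℝ) / (P.U : ℝ)) ((P.q2z : ℝ) / (P.U : ℝ)) hx hy hsq'
  -- corner values
  have c00 := P.gCornerLo_le hP k ha1 ha2 hc1 hc2
  have c10 := P.gCornerLo_le hP k hb1 hb2 hc1 hc2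
  have c01 := P.gCornerLo_le hP k ha1 ha2 hd1 hd2
  have c11 := P.gCornerLo_le hP k hb1 hb2 hd1 hd2
  have u00 := P.le_gCornerUp hP k ha1 ha2 hc1 hc2
  have u10 := P.le_gCornerUp hP k hb1 hb2 hc1 hc2
  have u01 := P.le_gCornerUp hP k ha1 ha2 hd1 hd2
  have u11 := P.le_gCornerUp hP k hb1 hb2 hd1 hd2
  rw [P.gfun_pt k] at c00 c10 c01 c11 u00 u10 u01 u11
  have hE := P.interpE_ge hP (b - a)
  rw [hh] at hE ⊢
  have harea : 0 < ((b : ℝ) / (P.U : ℝ) - (a : ℝ) / (P.U : ℝ)) ^ 2 := by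
    have : 0 < (b : ℝ) / (P.U : ℝ) - (a : ℝ) / (P.U : ℝ) := by linarith
    positivity
  rw [hI]
  push_cast
  rw [abs_le] at hcm
  obtain ⟨hcm1, hcm2⟩ := hcm
  rw [hsq'] at hcm1 hcm2
  have kE := mul_le_mul_of_nonneg_left hE harea.le
  cases k with
  | true =>
    simp only [↓reduceIte, one_mul] at c00 c10 c01 c11 u00 u10 u01 u11 ⊢
    rw [div_le_iff₀ (by positivity)] at c00 c10 c01 c11
    rw [le_div_iff₀ (by positivity)] at u00 u10 u01 u11
    have k1 := mul_le_mul_of_nonneg_left c00 harea.le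
    have k2 := mul_le_mul_of_nonneg_left c10 harea.le
    have k3 := mul_le_mul_of_nonneg_left c01 harea.le
    have k4 := mul_le_mul_of_nonneg_left c11 harea.le
    have k5 := mul_le_mul_of_nonneg_left u00 harea.le
    have k6 := mul_le_mul_of_nonneg_left u10 harea.le
    have k7 := mul_le_mul_of_nonneg_left u01 harea.le
    have k8 := mul_le_mul_of_nonneg_left u11 harea.le
    constructor
    · linarith
    · linarith
  | false =>
    simp only [Bool.false_eq_true, ↓reduceIte, neg_mul, one_mul] at c00 c10 c01 c11 u00 u10 u01 u11 ⊢
    rw [div_le_iff₀ (by positivity)] at c00 c10 c01 c11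
    rw [le_div_iff₀ (by positivity)] at u00 u10 u01 u11
    have k1 := mul_le_mul_of_nonneg_left c00 harea.le
    have k2 := mul_le_mul_of_nonneg_left c10 harea.le
    have k3 := mul_le_mul_of_nonneg_left c01 harea.le
    have k4 := mul_le_mul_of_nonneg_left c11 harea.le
    have k5 := mul_le_mul_of_nonneg_left u00 harea.le
    have k6 := mul_le_mul_of_nonneg_left u10 harea.le
    have k7 := mul_le_mul_of_nonneg_left u01 harea.le
    have k8 := mul_le_mul_of_nonneg_left u11 harea.le
    constructor
    · linarith
    · linarith

/-- **THE TRIVIAL LOWER BOUND**: `h²·Glo/2^40 ≤ ∫_cell g_k` on a two-shell cell (pointwise `g ≥ Glo/2^40`, cell measure `h²`… for a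
general oriented cell `(b−a)(d−c)/U²`). -/
theorem Params.integral_gfun_ge_gLo (P : Params) (hP : P.admissible = true) {a b c d : ℤ} (hin : P.InRoot a b c d)
    (hab : a ≤ b) (hcd : c ≤ d) {k : Bool}
    (hg : (P.cell (P.mkX a) (P.mkX b) (P.mkY c) (P.mkY d)).guards = true)
    (hs1 : P.status (P.cell (P.mkX a) (P.mkX b) (P.mkY c) (P.mkY d)).e1Lo (P.cell (P.mkX a) (P.mkX b) (P.mkY c) (P.mkY d)).e1Hi = some k)
    (hs2 : P.status (P.cell (P.mkX a) (P.mkX b) (P.mkY c) (P.mkY d)).e2Lo (P.cell (P.mkX a) (P.mkX b) (P.mkY c) (P.mkY d)).e2Hi = some (!k)) :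
    ((b : ℝ) - (a : ℝ)) * ((d : ℝ) - (c : ℝ)) / ((P.U : ℝ) ^ 2) *
        ((((P.cell (P.mkX a) (P.mkX b) (P.mkY c) (P.mkY d)).gLo k : ℤ) : ℝ) / 2 ^ 40)
      ≤ ∫ p in P.cellSet a b c d, P.gfun k p := by
  obtain ⟨-, -, hU, -, -⟩ := P.admissible_facts hP
  have hmeas := P.measurableSet_cellSet a b c d
  have hconst := setIntegral_const (μ := volume) (s := P.cellSet a b c d)
    ((((P.cell (P.mkX a) (P.mkX b) (P.mkY c) (P.mkY d)).gLo k : ℤ) : ℝ) / 2 ^ 40)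
  rw [P.volumeReal_cellSet hU hab hcd, smul_eq_mul] at hconst
  rw [← hconst]
  exact setIntegral_mono_on (integrableOn_const (hs := (P.volume_cellSet_lt_top a b c d).ne)) (P.gfun_integrableOn k a b c d)
    hmeas fun p hp => (P.twoShell_gfun_mem hP hin hg hs1 hs2 hp).1

end Summit.HubbardSuperconductivity.HubbardSuperconductivity.Theorems.KlLindhardEnclosure

end
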